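import Mathlib
import HarnessLib
import Summits.ValiantsHypothesis.ValiantsHypothesis.Theorems.MonotoneRestorationOrbitRestorationQPCorePatterns

/-!
# Core patterns, polynomial version: all-placements sums of ANY polynomial in the local atoms are narrow

Route MonotoneRestoration, crux `OrbitRestorationQP` (stmt-ValiantsHypothesis-18293), SPAN-currency lane of the open
sub-rung A_∞ (`stub_sigmaPiSigmaValue`).  Helper (`--supports`), def-free.  Generalises the ENGINE
`CorePatterns.sum_placements_pow_localForm_mem_narrowSpan` (powers of a local LINEAR form) to arbitrary polynomials in
the local atoms `x_{ab}` (`a ∈ R = Fin r`, `b ∈ C = Fin c`), `R_a` (row sums), `C_b` (column sums):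

* `exists_word_of_finsupp` — a monomial exponent `s : atoms →₀ ℕ` is realised by a WORD `w : Fin K → atoms`:
  `s.prod (fun t k => A t ^ k) = Π_i A (w i)` uniformly in the commutative monoid and the valuation `A`;
* **`sum_placements_aeval_mem_narrowSpan`** — THE POLYNOMIAL ENGINE: for every
  `P ∈ ℂ[atoms] = MvPolynomial ((Fin r × Fin c) ⊕ (Fin r ⊕ Fin c)) ℂ`, the all-placements sum
  `Σ_{φ : R → [n], ψ : C → [n]} P(x_{φ a, ψ b}, R_{φ a}, C_{ψ b})` lies in `span_ℂ {hom_{F,n} : tw F ≤ r + c}`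
  (expand `P` into monomials, each monomial into a word, each word into a core-pattern triple product
  `CorePatterns.exists_lists_of_word`, each of which is a narrow generator `CorePatterns.corePattern_mem_narrowSpan`).

Why (lane note): the twisted residue of the `ΠΣ` sub-rung groups eigen-factors into stabiliser-orbit products, which
are exactly permuted families of LOCAL FORMS OF BOUNDED DEGREE (up to sign characters); their treatment in span currency
needs the engine for polynomial (not just linear) local forms — this file.  No registered stub is closed; the crux and
VP ≠ VNP are not moved. [folklore]
-/

noncomputable section

-- `Summit.ValiantsHypothesis.ValiantsHypothesis.…` is the tree's single-conjunct layout (Sub = Summit).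
set_option linter.dupNamespace false

namespace Summit.ValiantsHypothesis.ValiantsHypothesis.Theorems

namespace CorePatterns

open MvPolynomial Finset
open Literature.Computability.AlgebraicComplexity (homPoly)
open Literature.Combinatorics.SimpleGraph (treewidth)

/-! ### Monomials as words -/

/-- **A monomial exponent is realised by a word**, uniformly in the valuation. [folklore] -/
theorem exists_word_of_finsupp {α : Type} [DecidableEq α] (s : α →₀ ℕ) :
    ∃ (K : ℕ) (w : Fin K → α), ∀ (M : Type) [CommMonoid M] (A : α → M),
      s.prod (fun t k => A t ^ k) = ∏ i : Fin K, A (w i) := by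
  classical
  set T := (t : {t // t ∈ s.support}) × Fin (s t) with hT
  set K := Fintype.card T with hK
  set e : T ≃ Fin K := Fintype.equivFin T with he
  refine ⟨K, fun i => ((e.symm i).1 : α), fun M _ A => ?_⟩
  calc s.prod (fun t k => A t ^ k) = ∏ t ∈ s.support, A t ^ s t := rfl
    _ = ∏ t : {t // t ∈ s.support}, A t ^ s t := (Finset.prod_coe_sort s.support fun t => A t ^ s t).symm
    _ = ∏ t : {t // t ∈ s.support}, ∏ _j : Fin (s t), A t := by
        refine Fintype.prod_congr _ _ fun t => ?_
        rw [Fin.prod_const]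
    _ = ∏ x : T, A x.1 := (Fintype.prod_sigma (fun x : T => A (x.1 : α))).symm
    _ = ∏ i : Fin K, A ((e.symm i).1 : α) := by
        rw [← Equiv.prod_comp e.symm (fun x : T => A (x.1 : α))]

/-! ### The polynomial engine -/

/-- Moving an inner finite sum past two outer sums. [folklore] -/
theorem sum_sum_sum_comm {α β γ M : Type*} [AddCommMonoid M] [Fintype α] [Fintype β] (t : Finset γ)
    (F : α → β → γ → M) :
    (∑ a, ∑ b, ∑ c ∈ t, F a b c) = ∑ c ∈ t, ∑ a, ∑ b, F a b c := by
  calc (∑ a, ∑ b, ∑ c ∈ t, F a b c) = ∑ a, ∑ c ∈ t, ∑ b, F a b c :=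
        Finset.sum_congr rfl fun a _ => Finset.sum_comm
    _ = ∑ c ∈ t, ∑ a, ∑ b, F a b c := Finset.sum_comm

/-- **All-placements sums of a polynomial in the local atoms are narrow, treewidth `≤ |core|`.**  For every
`P ∈ MvPolynomial ((Fin r × Fin c) ⊕ (Fin r ⊕ Fin c)) ℂ` (atoms: cells `x_{ab}`, row sums `R_a`, column sums `C_b`),
`Σ_{φ, ψ} P(x_{φ a, ψ b}, R_{φ a}, C_{ψ b}) ∈ span_ℂ {hom_{F,n} : tw F ≤ r + c}`. [folklore; cite: DwivediPagoSeppelt2026, §8] -/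
theorem sum_placements_aeval_mem_narrowSpan (n r c : ℕ) (P : MvPolynomial ((Fin r × Fin c) ⊕ (Fin r ⊕ Fin c)) ℂ) :
    (∑ φ : Fin r → Fin n, ∑ ψ : Fin c → Fin n,
      aeval (Sum.elim (fun ab : Fin r × Fin c => (X (φ ab.1, ψ ab.2) : MvPolynomial (Fin n × Fin n) ℂ))
          (Sum.elim (fun a : Fin r => ∑ j : Fin n, (X (φ a, j) : MvPolynomial (Fin n × Fin n) ℂ))
            (fun b : Fin c => ∑ j : Fin n, (X (j, ψ b) : MvPolynomial (Fin n × Fin n) ℂ)))) P) ∈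
    Submodule.span ℂ {p : MvPolynomial (Fin n × Fin n) ℂ |
        ∃ (a b : ℕ) (E : Multiset (Fin a × Fin b)),
          treewidth (SimpleGraph.fromRel fun u v : Fin a ⊕ Fin b =>
            ∃ e ∈ E, u = Sum.inl e.1 ∧ v = Sum.inr e.2) ≤ r + c ∧ p = homPoly E n ℂ} := by
  classical
  -- expand `P` into monomials
  have hP : ∀ (φ : Fin r → Fin n) (ψ : Fin c → Fin n),
      aeval (Sum.elim (fun ab : Fin r × Fin c => (X (φ ab.1, ψ ab.2) : MvPolynomial (Fin n × Fin n) ℂ))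
          (Sum.elim (fun a : Fin r => ∑ j : Fin n, (X (φ a, j) : MvPolynomial (Fin n × Fin n) ℂ))
            (fun b : Fin c => ∑ j : Fin n, (X (j, ψ b) : MvPolynomial (Fin n × Fin n) ℂ)))) P =
      ∑ s ∈ P.support, C (coeff s P) *
        s.prod (fun t k => (Sum.elim (fun ab : Fin r × Fin c => (X (φ ab.1, ψ ab.2) : MvPolynomial (Fin n × Fin n) ℂ))
          (Sum.elim (fun a : Fin r => ∑ j : Fin n, (X (φ a, j) : MvPolynomial (Fin n × Fin n) ℂ))
            (fun b : Fin c => ∑ j : Fin n, (X (j, ψ b) : MvPolynomial (Fin n × Fin n) ℂ))) t) ^ k) := by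
    intro φ ψ
    conv_lhs => rw [P.as_sum]
    rw [map_sum]
    refine Finset.sum_congr rfl fun s _ => ?_
    rw [aeval_monomial, algebraMap_eq]
  simp_rw [hP]
  rw [sum_sum_sum_comm]
  refine Submodule.sum_mem _ fun s _ => ?_
  obtain ⟨K, w, hw⟩ := exists_word_of_finsupp s
  obtain ⟨m₁, cells, m₂, rp, m₃, cp, h⟩ := exists_lists_of_word r c K w
  have hterm : ∀ (φ : Fin r → Fin n) (ψ : Fin c → Fin n),
      C (coeff s P) *
        s.prod (fun t k => (Sum.elim (fun ab : Fin r × Fin c => (X (φ ab.1, ψ ab.2) : MvPolynomial (Fin n × Fin n) ℂ))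
          (Sum.elim (fun a : Fin r => ∑ j : Fin n, (X (φ a, j) : MvPolynomial (Fin n × Fin n) ℂ))
            (fun b : Fin c => ∑ j : Fin n, (X (j, ψ b) : MvPolynomial (Fin n × Fin n) ℂ))) t) ^ k) =
      C (coeff s P) *
        ((∏ i : Fin m₁, (X (φ (cells i).1, ψ (cells i).2) : MvPolynomial (Fin n × Fin n) ℂ)) *
          (∏ i : Fin m₂, ∑ j : Fin n, (X (φ (rp i), j) : MvPolynomial (Fin n × Fin n) ℂ)) *
          (∏ i : Fin m₃, ∑ j : Fin n, (X (j, ψ (cp i)) : MvPolynomial (Fin n × Fin n) ℂ))) := by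
    intro φ ψ
    rw [hw (MvPolynomial (Fin n × Fin n) ℂ), h n φ ψ]
  simp_rw [hterm]
  simp_rw [← Finset.mul_sum]
  rw [← MvPolynomial.smul_eq_C_mul]
  exact Submodule.smul_mem _ _ (corePattern_mem_narrowSpan n r c m₁ m₂ m₃ cells rp cp)

end CorePatterns

end Summit.ValiantsHypothesis.ValiantsHypothesis.Theorems

end
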